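import Mathlib
import Literature.Barriers.NavierStokesRegularity.DyadicCascadeRegularity
import Literature.Barriers.NavierStokesRegularity.DyadicInvariantRegion
import HarnessLib

/-!
# The invariant region in the original variables: `sup_n λₙ^{β-2+ε} Xₙ` stays bounded
  (BMR 2011, Lemma 2.1 applied as in the proof of Thm. 1, §3.2, first claim)

Barrier catalogue `Literature/Barriers/NavierStokesRegularity/`, proof file towards the named fact
`Dyadic.BarbatoMorandinRomito2011_thm1` (`DyadicCascadeRegularity`). We transport the abstract
invariant-region lemma `invariantRegion_le_one` (`DyadicInvariantRegion.lean`) back to a truncated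
solution of BMR (1.1), exactly as in the proof of Theorem 1 (§3.2, pp. 7–8 of the arXiv text):
given a solution `X` of the `N`-mode truncation (modes `1 … N` solve (1.1) on `[t₀, ∞)`,
`X_{N+1} = λ^{-a} X_N` with `a = β - 2 + ε`, i.e. `Y_{N+1} = Y_N`, all modes non-negative) with
`K₀ := sup_n λₙ^a Xₙ(t₀)` finite, the rescaled family
`Ȳₙ(s) = (δ/K₀) λₙ^a Xₙ(t₀ + (δ/K₀) s)` "is solution to (e:Yeq) but with viscosity `ν̄ = (δ/K₀)ν`",
starts in `[0, δ]`, hence stays `≤ 1` by Lemma 2.1, "and in turns `λ^{β-2+ε} Xₙ(t) ≤ K₀/δ` for all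
`n ≥ 1` and `t ≥ t₀`" (`rpow_mul_le_of_truncated`). The content of this file is the bookkeeping of
exponents (`λₙ = 2ⁿ`): in the variables `Yₙ = λₙ^a Xₙ` the field of (1.1) becomes
`-νλₙ²Yₙ + λ^{β-4+2ε}λₙ^{2-ε}(Y_{n-1}² - λ^{6-2β-3ε}YₙY_{n+1})` (BMR (e:Yeq), "a straightforward
computation"), and the time–amplitude scaling `X ↦ κX(κ·)` maps solutions to solutions with
`ν ↦ κν`. Theorem-only module.

## References

* D. Barbato, F. Morandin, M. Romito, *Smooth solutions for the dyadic model*, Nonlinearity 24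
  (2011) 3083–3097, §2 (e:Yeq), Lemma 2.1; §3.2, proof of Thm. 1, first claim
  (arXiv:1007.3401, pp. 4, 7–8). [`BarbatoMorandinRomito2011`]
-/

noncomputable section

open Set Filter Topology

namespace Literature.Barriers.NavierStokesRegularity.Dyadic

/-! ## Wave numbers as real powers of two -/

/-- `λₙ = 2ⁿ` as a real power, `n ≥ 1`. [cite: BarbatoMorandinRomito2011, §1.1 (1.1)] -/
theorem bmrLambda_eq_two_rpow {n : ℕ} (hn : n ≠ 0) : bmrLambda n = (2 : ℝ) ^ (n : ℝ) := by
  rw [bmrLambda_of_ne_zero hn, Real.rpow_natCast]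

/-- `λₙ^s = 2^{ns}`, `n ≥ 1`. [folklore] -/
theorem bmrLambda_rpow_eq {n : ℕ} (hn : n ≠ 0) (s : ℝ) : bmrLambda n ^ s = (2 : ℝ) ^ ((n : ℝ) * s) := by
  rw [bmrLambda_eq_two_rpow hn, ← Real.rpow_mul (by norm_num)]

/-- `λₙ² = 2^{2n}` (real power), `n ≥ 1`. [folklore] -/
theorem bmrLambda_sq_eq {n : ℕ} (hn : n ≠ 0) : bmrLambda n ^ 2 = (2 : ℝ) ^ (2 * (n : ℝ)) := by
  rw [bmrLambda_eq_two_rpow hn, ← Real.rpow_natCast, ← Real.rpow_mul (by norm_num)]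
  push_cast; ring_nf

/-- Products of real powers of two. [folklore] -/
theorem two_rpow_mul_two_rpow (x y : ℝ) : (2 : ℝ) ^ x * (2 : ℝ) ^ y = (2 : ℝ) ^ (x + y) := by
  rw [Real.rpow_add (by norm_num)]

/-- `λ_{n+1}^a · 2^{-a} = λₙ^a` (`n ≥ 1`): the slaving `X_{N+1} = 2^{-a}X_N` of the truncation is
`Y_{N+1} = Y_N` in the weighted variables. [cite: BarbatoMorandinRomito2011, §2 (e:YNeq)] -/
theorem bmrLambda_succ_rpow_mul {n : ℕ} (hn : n ≠ 0) (a : ℝ) :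
    bmrLambda (n + 1) ^ a * (2 : ℝ) ^ (-a) = bmrLambda n ^ a := by
  rw [bmrLambda_rpow_eq (Nat.succ_ne_zero n), bmrLambda_rpow_eq hn, two_rpow_mul_two_rpow]
  congr 1; push_cast; ring

/-! ## The field of (1.1) in the weighted variables `Yₙ = λₙ^a Xₙ`, `a = β - 2 + ε` -/

section Identities

variable {β ε a : ℝ}

/-- Dissipation: `λₙ^a · λₙ² = 2^{2n} λₙ^a`. [folklore] -/
theorem weight_mul_sq {n : ℕ} (hn : n ≠ 0) (a : ℝ) :
    bmrLambda n ^ a * bmrLambda n ^ 2 = (2 : ℝ) ^ (2 * (n : ℝ)) * bmrLambda n ^ a := by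
  rw [bmrLambda_sq_eq hn, mul_comm]

/-- Production: `λₙ^a λ_{n-1}^β = λ^{β-4+2ε} λₙ^{2-ε} (λ_{n-1}^a)²` for `a = β - 2 + ε`, `n ≥ 1`
(both sides vanish for `n = 1`). [cite: BarbatoMorandinRomito2011, §2 (e:Yeq)] -/
theorem weight_mul_production (hβ : β ≠ 0) (ha : a = β - 2 + ε) (ha0 : a ≠ 0) {n : ℕ} (hn : 1 ≤ n) :
    bmrLambda n ^ a * bmrLambda (n - 1) ^ β =
      (2 : ℝ) ^ (β - 4 + 2 * ε) * (2 : ℝ) ^ ((2 - ε) * (n : ℝ)) * (bmrLambda (n - 1) ^ a) ^ 2 := by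
  rcases Nat.exists_eq_add_of_le hn with ⟨k, rfl⟩
  rcases k with _ | k
  · simp [Real.zero_rpow hβ, Real.zero_rpow ha0]
  · have h1 : 1 + (k + 1) - 1 = k + 1 := by omega
    rw [h1, bmrLambda_rpow_eq (by omega), bmrLambda_rpow_eq (by omega), bmrLambda_rpow_eq (by omega),
      sq, two_rpow_mul_two_rpow, two_rpow_mul_two_rpow, two_rpow_mul_two_rpow, two_rpow_mul_two_rpow]
    congr 1; push_cast; rw [ha]; ring

/-- Transport: `λₙ^a λₙ^β = λ^{β-4+2ε} λₙ^{2-ε} λ^{6-2β-3ε} λₙ^a λ_{n+1}^a` for `a = β - 2 + ε`,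
`n ≥ 1`. [cite: BarbatoMorandinRomito2011, §2 (e:Yeq)] -/
theorem weight_mul_transport (ha : a = β - 2 + ε) {n : ℕ} (hn : n ≠ 0) :
    bmrLambda n ^ a * bmrLambda n ^ β =
      (2 : ℝ) ^ (β - 4 + 2 * ε) * (2 : ℝ) ^ ((2 - ε) * (n : ℝ)) * (2 : ℝ) ^ (6 - 2 * β - 3 * ε) *
        bmrLambda n ^ a * bmrLambda (n + 1) ^ a := by
  rw [bmrLambda_rpow_eq hn, bmrLambda_rpow_eq hn, bmrLambda_rpow_eq (Nat.succ_ne_zero n),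
    two_rpow_mul_two_rpow, two_rpow_mul_two_rpow, two_rpow_mul_two_rpow, two_rpow_mul_two_rpow,
    two_rpow_mul_two_rpow]
  congr 1; push_cast; rw [ha]; ring

/-- **The rescaled weighted field** ("it turns out that `Ȳ` is solution to (e:Yeq) but with
viscosity `ν̄ = κ₀ν`"): for a state `X`, `n ≥ 1`, `a = β - 2 + ε` and a scale `κ₀`,
`κ₀λₙ^a · κ₀RHSₙ(X) = -(κ₀ν2^{2n})Ȳₙ + λ^{β-4+2ε}2^{(2-ε)n}(Ȳ_{n-1}² - λ^{6-2β-3ε}ȲₙȲ_{n+1})`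
with `Ȳₘ = κ₀λₘ^aXₘ`. [cite: BarbatoMorandinRomito2011, §2 (e:Yeq) and §3.2 (proof of Thm. 1)] -/
theorem rescaled_bmrRHS (hβ : β ≠ 0) (ha : a = β - 2 + ε) (ha0 : a ≠ 0) {n : ℕ} (hn : 1 ≤ n)
    (ν κ₀ : ℝ) (X : ℕ → ℝ) :
    κ₀ * bmrLambda n ^ a * (κ₀ * bmrRHS ν β X n) =
      -(κ₀ * ν * (2 : ℝ) ^ (2 * (n : ℝ))) * (κ₀ * bmrLambda n ^ a * X n) +
        (2 : ℝ) ^ (β - 4 + 2 * ε) * (2 : ℝ) ^ ((2 - ε) * (n : ℝ)) *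
          ((κ₀ * bmrLambda (n - 1) ^ a * X (n - 1)) ^ 2 -
            (2 : ℝ) ^ (6 - 2 * β - 3 * ε) * (κ₀ * bmrLambda n ^ a * X n) *
              (κ₀ * bmrLambda (n + 1) ^ a * X (n + 1))) := by
  have hn0 : n ≠ 0 := by omega
  have J0 := weight_mul_sq hn0 a
  have J1 := weight_mul_production hβ ha ha0 hn
  have J2 := weight_mul_transport ha hn0
  unfold bmrRHS
  linear_combination (-(κ₀ ^ 2 * ν * X n)) * J0 + (κ₀ ^ 2 * X (n - 1) ^ 2) * J1 -
    (κ₀ ^ 2 * X n * X (n + 1)) * J2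

end Identities

/-! ## Lemma 2.1 for truncated solutions of (1.1) -/

/-- **Barbato–Morandin–Romito 2011, Lemma 2.1 as used in the proof of Thm. 1 (§3.2, first
claim): the weighted supremum cannot grow by more than the factor `1/δ = 10`.** Let `ν > 0`,
`β ∈ (2, 5/2]`, `ε ∈ (0, 1/100]`, `a = β - 2 + ε`, `N ≥ 1`, and let `X` solve the `N`-mode
truncation of (1.1) from time `t₀`: modes `1 ≤ n ≤ N` are continuous on `[t₀, ∞)` with right
derivatives `RHSₙ(X(t))` there, `X_{N+1} = 2^{-a} X_N` (BMR's closure `Y_{N+1} = Y_N` of (e:YNeq)),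
and `Xₙ ≥ 0` for `n ≤ N + 1`. If `λₙ^a Xₙ(t₀) ≤ K` for `1 ≤ n ≤ N` with `K > 0`, then
`λₙ^a Xₙ(t) ≤ 10 K` for all `t ≥ t₀`, `1 ≤ n ≤ N`. Proof: `Ȳₙ(s) = κ₀λₙ^aXₙ(t₀ + κ₀s)`,
`κ₀ = 1/(10K)`, solves the abstract system of `invariantRegion_le_one` with `κₙ = κ₀ν4ⁿ`,
`Fₙ = λ^{β-4+2ε}λ^{(2-ε)n}`, `L = λ^{2-ε}`, `p = λ^γ`, `c = λ^{-γ}` and starts in `[0, δ]`.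
[cite: BarbatoMorandinRomito2011, §2 Lemma 2.1 and §3.2 (proof of Thm. 1, first claim)] -/
theorem rpow_mul_le_of_truncated {ν β ε a K t₀ : ℝ} {N : ℕ} {X : ℕ → ℝ → ℝ}
    (hν : 0 < ν) (hβ2 : 2 < β) (hβ52 : β ≤ 5 / 2) (hε0 : 0 < ε) (hε1 : ε ≤ 1 / 100)
    (ha : a = β - 2 + ε) (hN : 1 ≤ N) (hK : 0 < K)
    (hcont : ∀ n, 1 ≤ n → n ≤ N → ContinuousOn (X n) (Ici t₀))
    (hderiv : ∀ n, 1 ≤ n → n ≤ N → ∀ t, t₀ ≤ t →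
      HasDerivWithinAt (X n) (bmrRHS ν β (fun m => X m t) n) (Ici t) t)
    (hslave : ∀ t, X (N + 1) t = (2 : ℝ) ^ (-a) * X N t)
    (hpos : ∀ n, n ≤ N + 1 → ∀ t, t₀ ≤ t → 0 ≤ X n t)
    (hinit : ∀ n, 1 ≤ n → n ≤ N → bmrLambda n ^ a * X n t₀ ≤ K) :
    ∀ n, 1 ≤ n → n ≤ N → ∀ t, t₀ ≤ t → bmrLambda n ^ a * X n t ≤ 10 * K := by
  have hβ0 : β ≠ 0 := by linarith
  have ha0 : a ≠ 0 := by rw [ha]; linarith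
  have hapos : 0 < a := by rw [ha]; linarith
  -- the scale
  set κ₀ : ℝ := 1 / (10 * K) with hκ₀
  have hκ₀pos : 0 < κ₀ := by rw [hκ₀]; positivity
  -- the rescaled weighted family
  set Y : ℕ → ℝ → ℝ := fun n s => κ₀ * bmrLambda n ^ a * X n (t₀ + κ₀ * s) with hY
  -- parameters of the abstract system
  set κ : ℕ → ℝ := fun n => κ₀ * ν * (2 : ℝ) ^ (2 * (n : ℝ)) with hκdef
  set F : ℕ → ℝ := fun n => (2 : ℝ) ^ (β - 4 + 2 * ε) * (2 : ℝ) ^ ((2 - ε) * (n : ℝ)) with hFdef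
  set L : ℝ := (2 : ℝ) ^ (2 - ε) with hLdef
  set p : ℝ := (2 : ℝ) ^ (6 - 2 * β - 3 * ε) with hpdef
  set c : ℝ := (2 : ℝ) ^ (-(6 - 2 * β - 3 * ε)) with hcdef
  have hmain := invariantRegion_le_one (N := N) (Y := Y) (κ := κ) (F := F) (L := L) (p := p) (c := c)
    (fun n => by positivity)
    (fun n => by
      simp only [hκdef]
      apply mul_le_mul_of_nonneg_left _ (by positivity)
      exact Real.rpow_le_rpow_of_exponent_le (by norm_num) (by push_cast; linarith))
    (fun n => by
      simp only [hκdef]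
      have : (2 : ℝ) ^ (2 * ((n + 1 : ℕ) : ℝ)) = 4 * (2 : ℝ) ^ (2 * (n : ℝ)) := by
        push_cast
        rw [show 2 * ((n : ℝ) + 1) = 2 * (n : ℝ) + 2 by ring, Real.rpow_add (by norm_num)]
        norm_num; ring
      rw [this]; ring_nf; exact le_rfl)
    (fun n => by positivity)
    (fun n => by
      simp only [hFdef, hLdef]
      have h2 : (2 : ℝ) ^ ((2 - ε) * ((n + 1 : ℕ) : ℝ)) =
          (2 : ℝ) ^ (2 - ε) * (2 : ℝ) ^ ((2 - ε) * (n : ℝ)) := by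
        rw [← Real.rpow_add (by norm_num)]
        congr 1; push_cast; ring
      rw [h2]; ring)
    (two_rpow_pos _) (two_rpow_mul_two_rpow_neg _) (two_rpow_gamma_le hβ2.le hε0.le)
    (two_rpow_neg_gamma_le_one hβ52 hε1) (two_rpow_two_sub_ge hε1)
    (two_rpow_neg_gamma_le hβ52 hε1) (two_rpow_two_sub_mul_neg_gamma_le hβ52 hε1)
    (fun s => by simp [hY, Real.zero_rpow ha0])
    (fun s => by
      simp only [hY]
      have hN0 : N ≠ 0 := by omega
      rw [hslave, ← bmrLambda_succ_rpow_mul hN0 a]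
      ring)
    ?cont ?deriv ?pos ?init
  rotate_left
  · -- continuity
    intro n hn
    simp only [hY]
    rcases Nat.eq_zero_or_pos n with rfl | hn1
    · simp only [bmrLambda_zero, Real.zero_rpow ha0, mul_zero, zero_mul]
      exact continuousOn_const
    · refine continuousOn_const.mul ((hcont n hn1 hn).comp (Continuous.continuousOn (by fun_prop)) ?_)
      intro s (hs : 0 ≤ s)
      show t₀ ≤ t₀ + κ₀ * s
      nlinarith
  · -- the rescaled equations
    intro n hn1 hnN s hs
    have hts : t₀ ≤ t₀ + κ₀ * s := by nlinarith
    have h1 : HasDerivWithinAt (X n) (bmrRHS ν β (fun m => X m (t₀ + κ₀ * s)) n) (Ici (t₀ + κ₀ * s))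
        (t₀ + κ₀ * s) := hderiv n hn1 hnN _ hts
    have h2 : HasDerivWithinAt (fun u : ℝ => t₀ + κ₀ * u) κ₀ (Ici s) s := by
      simpa using (((hasDerivAt_id s).const_mul κ₀).const_add t₀).hasDerivWithinAt
    have h3 : HasDerivWithinAt (fun u => X n (t₀ + κ₀ * u))
        (κ₀ • bmrRHS ν β (fun m => X m (t₀ + κ₀ * s)) n) (Ici s) s :=
      h1.scomp s h2 (fun u (hu : s ≤ u) => show t₀ + κ₀ * s ≤ t₀ + κ₀ * u by nlinarith)
    rw [smul_eq_mul] at h3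
    have h4 := h3.const_mul (κ₀ * bmrLambda n ^ a)
    simp only [hY, hκdef, hFdef, hpdef]
    refine h4.congr_deriv ?_
    exact rescaled_bmrRHS hβ0 ha ha0 hn1 ν κ₀ (fun m => X m (t₀ + κ₀ * s))
  · -- positivity
    intro n hn s hs
    simp only [hY]
    exact mul_nonneg (mul_nonneg hκ₀pos.le (Real.rpow_nonneg (bmrLambda_nonneg n) a))
      (hpos n hn _ (by nlinarith))
  · -- initial smallness
    intro n hn1 hnN
    simp only [hY, mul_zero, add_zero]
    have := hinit n hn1 hnN
    rw [mul_assoc, hκ₀]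
    rw [div_mul_eq_mul_div, one_mul, div_le_iff₀ (by positivity)]
    linarith
  -- read off the bound
  intro n hn1 hnN t ht
  have hs : 0 ≤ (t - t₀) / κ₀ := div_nonneg (by linarith) hκ₀pos.le
  have := hmain n hn1 hnN ((t - t₀) / κ₀) hs
  simp only [hY] at this
  have hts : t₀ + κ₀ * ((t - t₀) / κ₀) = t := by field_simp; ring
  rw [hts] at this
  rw [hκ₀] at this
  have h10 : (0 : ℝ) < 10 * K := by positivity
  calc bmrLambda n ^ a * X n t = (10 * K) * (1 / (10 * K) * bmrLambda n ^ a * X n t) := by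
        field_simp
    _ ≤ (10 * K) * 1 := mul_le_mul_of_nonneg_left this h10.le
    _ = 10 * K := mul_one _

end Literature.Barriers.NavierStokesRegularity.Dyadic
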